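import Literature.AlgebraicGeometry.HodgeTheory.DivisorLefschetzGroupCommutant
import Literature.AlgebraicGeometry.HodgeTheory.WeilClassesFieldDecomposableIffDivisorLefschetzGroup
import HarnessLib

/-!
# Moonen–Zarhin's Criterion (2) on the carrier WITH Lemma (3) built in: `W_F` decomposable ⟺ `F ⊆ B` and
# `G_div(X) ⊆ Sl_F(V_X)`; `F ⊄ B` ⟹ ALL non-zero Weil classes relative to `F` are EXCEPTIONAL — outright, for every
# complex abelian variety of positive dimension and every polarization class

Layer `Literature/AlgebraicGeometry/HodgeTheory`; THEOREMS ONLY — no definition, no named fact, sorry-free (D-0026,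
net debt 0). Junction of the seat's `HodgeTheory/WeilClassesFieldDecomposableIffDivisorLefschetzGroup` (g14-#3: on
the carrier, «`W_F` decomposable ⟺ every `u ∈ G_div(X)(ℂ)` is `F`-linear with `det(u | V_ρ) = 1`»; «ONE `u` not
commuting with `φ^*` makes `W_F` exceptional») with `HodgeTheory/DivisorLefschetzGroupCommutant` (g16-#1 + the
generation-17 rider: LEMMA (3), first clause, `⊗ ℂ` — «`End(V_X)^{G_div(X)} = B`», i.e. `T` commutes with all of
`G_div(X)(h)(ℂ)` iff `T ∈ B ⊗ ℂ` — for every complex abelian variety of positive dimension and every rational `h` with a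
Kähler multiple). The print's «In the “only if” direction this follows from Lemmas (2) and (3)» becomes a THEOREM of
the carrier: decomposable ⟹ `φ^* ∈ B ⊗ ℂ`; contrapositively `φ^* ∉ B ⊗ ℂ` ⟹ `W_F ⊗ ℂ ⊓ 𝒟ᵐ ⊗ ℂ = 0`.

## The print

B. J. J. Moonen, Yu. G. Zarhin, *Weil classes on abelian varieties*, J. reine angew. Math. **496** (1998) =
arXiv:alg-geom/9612017 [MoonenZarhin1998WeilClasses] (held text `paper:arxiv-alg-geom_9612017`), §1: chunk p0002
L54–L58 «Let `S_λ ⊆ End⁰(X)` be the set of `†`-symmetric elements. We define the algebra `B ⊆ End⁰(X)` as the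
`ℚ`-subalgebra generated by `S_λ`.»; chunk p0003 L5 «(3) `End(V_X)^{G_div(X)} = B`»; Criterion (2) (chunk p0003
L46–L58) «… Then either all classes in `W_F` are decomposable, or all non-zero classes in `W_F` are exceptional; this
last possibility occurs precisely in the following cases: `Y` is of Type 3, `m = 1` and `F ⊄ E`, … `Y` is of Type 4,
`d = 1`, `m = 1` and `F ⊄ E₀`, …»; its proof (chunk p0003 L62–L66, verbatim) «We claim that, in these cases, `G_div(X)`
acts as the identity on `W_F` if and only if `F ⊆ B`. In the “only if” direction this follows from Lemmas (2) and
(3).»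

## The carrier (as in g13-#6 / g14-#3 / g16-#1)

`V ⊗ ℂ = H¹(A(ℂ); ℂ) = complexBetti A.X 1`; `S_λ ⊗ ℂ = symmetricPullbackSpan A h`; `B ⊗ ℂ = Algebra.adjoin ℂ (S_λ ⊗ ℂ)`;
`G_div(X)(h)(ℂ) = divisorLefschetzGroup A h`; `F = ℚ(φ)` with `P(φ) = 0`, `P ∈ ℤ[T]` monic irreducible of degree `e`,
`e · 2m = 2 dim A`; `W_F ⊗ ℂ = weilClassesField A φ P (2m)`; `𝒟ᵐ ⊗ ℂ = divisorClassesSpan A.X A.dim m`;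
`det(u | V_ρ) = VanGeemen1994.detOnEigenspace`; the polarization: `h` rational (`IsRationalClass h`) with `s · h` Kähler
for a real `s ≠ 0` — then `h ∈ B¹(A) ⊗ ℂ` and `Q_h` is non-degenerate (the tree's
`mem_hodgeClassSpan_one_of_isKaehlerClass_smul`, `eq_zero_of_forall_polarizationPairingOne_eq_zero_of_isKaehlerClass_smul'`).

## What is proved (`0 < dim A`, `h` rational with a Kähler multiple, `P`, `φ`, `e`, `m` as above)

* §1 **`pullbackOne_mem_adjoin_of_weilClassesField_le_divisorClassesSpan`** — «only if»: `W_F ⊗ ℂ ≤ 𝒟ᵐ ⊗ ℂ` ⟹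
  `φ^* ∈ B ⊗ ℂ` (g14-#3: decomposable ⟹ every `u ∈ G_div(X)(ℂ)` commutes with `φ^*`; Lemma (3) `⊗ ℂ`: ⟹ `φ^* ∈ B ⊗ ℂ`).
* §1 **`weilClassesField_inf_divisorClassesSpan_eq_bot_of_not_mem_adjoin`** — `φ^* ∉ B ⊗ ℂ`, `m ≠ 0` ⟹
  `W_F ⊗ ℂ ⊓ 𝒟ᵐ ⊗ ℂ = ⊥`: ALL NON-ZERO WEIL CLASSES RELATIVE TO `F` ARE EXCEPTIONAL (none is a `ℂ`-combination of
  products of divisor classes) — the alternative of the print's cases «Type 3, `m = 1`, `F ⊄ E`» (`B = E`) and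
  «Type 4, `d = 1`, `m = 1`, `F ⊄ E₀`» (`B = E₀`), granted the identification of `B` there (not used here).
* §2 **`weilClassesField_le_divisorClassesSpan_iff_mem_adjoin_and_forall_detOnEigenspace_eq_one`** — CRITERION (2) ON
  THE CARRIER: `W_F ⊗ ℂ ≤ 𝒟ᵐ ⊗ ℂ` ⟺ (`φ^* ∈ B ⊗ ℂ` AND `det(u | V_ρ) = 1` for every `u ∈ G_div(X)(ℂ)` and every complex
  root `ρ` of `P`); and **`weilClassesField_inf_divisorClassesSpan_eq_bot_iff_not_mem_adjoin_or`** (`m ≠ 0`) —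
  `W_F ⊗ ℂ ⊓ 𝒟ᵐ ⊗ ℂ = ⊥` ⟺ (`φ^* ∉ B ⊗ ℂ` OR some `u ∈ G_div(X)(ℂ)` commuting with `φ^*` has `det(u | V_ρ) ≠ 1` at some
  root).

Scope (said once): carrier statements, for EVERY complex abelian variety of positive dimension and every such `h`;
the `Sl_F` half of the criterion stays a condition on `ℂ`-points (settled outright by the seat's
`WeilClassesFieldDecomposableOfSymmetric` / `…OfSkew` when `φ` is Rosati-symmetric, resp. Rosati-skew with a symmetric
anticommuting unit); NOT here: the identification of `B` by Albert type (Table 1), `G_div` as an algebraic `ℚ`-group,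
Tate classes.

## References

* [MoonenZarhin1998WeilClasses] B. J. J. Moonen, Yu. G. Zarhin, J. reine angew. Math. 496 (1998) =
  arXiv:alg-geom/9612017, §1: `S_λ`, `B` (chunk p0002 L54–L58), Lemma (3) (chunk p0003 L5–L12), Criterion (2) and
  its proof (chunk p0003 L46–L70).
* [Milne1999LefschetzClasses] J. S. Milne, Lefschetz classes on abelian varieties, Duke Math. J. 96 (1999), Thm. 3.2,
  Cor. 4.5.
* [VoisinHodgeI2002] C. Voisin, Hodge Theory and Complex Algebraic Geometry I (CUP 2002), §7.1.2 (Kähler classes are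
  of type `(1,1)`), Thm. 6.25 (hard Lefschetz).

## Provenance

Lane `lit-hodgefound` (Track 2, Layer A), prover seat `lit-hodgefound-p21` (generation 17), row g17-#6: junction of
g14-#3 with g16-#1 — successor note (b) of generation 16 («converse of Criterion (2)») in the half that needs no
algebraic-group input.
-/

noncomputable section

open CategoryTheory Polynomial Module

namespace Literature.AlgebraicGeometry.HodgeTheory

open Literature.AlgebraicGeometry.Motives
open Literature.AlgebraicGeometry.VanGeemen1994 (hodgeClassSpan pullbackOne detOnEigenspace)
open Literature.AlgebraicGeometry.Milne1999
open Literature.AlgebraicTopology.SingularHomology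
open Literature.Barriers.HodgeConjecture (divisorClassesSpan)

section HodgeTheory

variable {A : AbelianVariety ℂ} {h : complexBetti A.X 2} {φ : A ⟶ A} {P : Polynomial ℤ} {e m : ℕ} {s : ℝ}

/-! ### §1 «In the “only if” direction this follows from Lemmas (2) and (3)»: decomposable ⟹ `φ^* ∈ B ⊗ ℂ` -/

/-- **`W_F` decomposable ⟹ `F ⊆ B`, on the carrier**: if `W_F ⊗ ℂ ≤ 𝒟ᵐ ⊗ ℂ` then `φ^* ∈ B ⊗ ℂ = Algebra.adjoin ℂ (S_λ ⊗ ℂ)`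
(`0 < dim A`; `h` rational with `s · h` Kähler, `s ≠ 0` real; `P ∈ ℤ[T]` monic irreducible of degree `e`, `P(φ) = 0`,
`e · 2m = 2 dim A`): every `u ∈ G_div(X)(ℂ)` commutes with `φ^*` (g14-#3's
`comm_pullbackOne_of_mem_divisorLefschetzGroup_of_le`, Lemma (2)), and an endomorphism commuting with all of
`G_div(X)(ℂ)` lies in `B ⊗ ℂ` (Lemma (3) `⊗ ℂ`, the tree's `forall_mem_divisorLefschetzGroup_comm_iff_mem_adjoin_of_isKaehlerClass'`).
[cite: MoonenZarhin1998WeilClasses, §1 Lemma (3) (chunk p0003 L5) and proof of Criterion (2) (chunk p0003 L62–L66)] -/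
theorem pullbackOne_mem_adjoin_of_weilClassesField_le_divisorClassesSpan (hA : 0 < A.dim)
    (hQ : IsRationalClass h) (hs : s ≠ 0) (hK : IsKaehlerClass A.dim A.X ((s : ℂ) • h))
    (hPm : P.Monic) (hPe : P.natDegree = e) (hPirr : Irreducible (P.map (Int.castRingHom ℚ)))
    (hφ : Polynomial.eval₂ (Int.castRingHom (CategoryTheory.End A)) (φ : CategoryTheory.End A) P = 0)
    (her : e * (2 * m) = 2 * A.dim)
    (hW : weilClassesField A φ P (2 * m) ≤ divisorClassesSpan A.X A.dim m) :
    pullbackOne A φ ∈ Algebra.adjoin ℂ (symmetricPullbackSpan A h : Set (Module.End ℂ (complexBetti A.X 1))) :=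
  (forall_mem_divisorLefschetzGroup_comm_iff_mem_adjoin_of_isKaehlerClass' hA hQ hs hK).1 fun _ hu y ↦
    (comm_pullbackOne_of_mem_divisorLefschetzGroup_of_le hPm hPe hPirr hφ her
      (mem_hodgeClassSpan_one_of_isKaehlerClass_smul hQ hs hK)
      (fun x hx ↦ eq_zero_of_forall_polarizationPairingOne_eq_zero_of_isKaehlerClass_smul' hs hK x hx) hW hu y).symm

/-- **`F ⊄ B` ⟹ ALL NON-ZERO WEIL CLASSES RELATIVE TO `F` ARE EXCEPTIONAL** — outright, on the carrier: if
`φ^* ∉ B ⊗ ℂ` (`m ≠ 0`, hypotheses as above) then `W_F ⊗ ℂ ⊓ 𝒟ᵐ ⊗ ℂ = ⊥` — no non-zero class of `W_F ⊗ ℂ` is a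
`ℂ`-combination of products of divisor classes. Road: Lemma (3) `⊗ ℂ` gives a `u ∈ G_div(X)(ℂ)` NOT commuting with `φ^*`;
then g14-#3's `weilClassesField_inf_divisorClassesSpan_eq_bot_of_not_comm` (all-or-nothing). This is the alternative
of the print's «Type 3, `m = 1` and `F ⊄ E`» and «Type 4, `d = 1`, `m = 1` and `F ⊄ E₀`» (there `B = E`, resp. `E₀` —
an identification not made here). [cite: MoonenZarhin1998WeilClasses, §1 Criterion (2) and its proof (chunk p0003 L46–L66), Lemma (3) (chunk p0003 L5)] -/
theorem weilClassesField_inf_divisorClassesSpan_eq_bot_of_not_mem_adjoin (hA : 0 < A.dim)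
    (hQ : IsRationalClass h) (hs : s ≠ 0) (hK : IsKaehlerClass A.dim A.X ((s : ℂ) • h))
    (hPm : P.Monic) (hPe : P.natDegree = e) (hPirr : Irreducible (P.map (Int.castRingHom ℚ)))
    (hφ : Polynomial.eval₂ (Int.castRingHom (CategoryTheory.End A)) (φ : CategoryTheory.End A) P = 0)
    (her : e * (2 * m) = 2 * A.dim) (hm : m ≠ 0)
    (hF : pullbackOne A φ ∉ Algebra.adjoin ℂ (symmetricPullbackSpan A h : Set (Module.End ℂ (complexBetti A.X 1)))) :
    weilClassesField A φ P (2 * m) ⊓ divisorClassesSpan A.X A.dim m = ⊥ := by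
  rcases weilClassesField_inf_divisorClassesSpan_eq_bot_or_le hPe hPirr hφ her hm with hbot | hle
  · exact hbot
  · exact absurd (pullbackOne_mem_adjoin_of_weilClassesField_le_divisorClassesSpan hA hQ hs hK hPm hPe hPirr hφ her hle) hF

/-- Element form: for `φ^* ∉ B ⊗ ℂ` (`m ≠ 0`), a class of `W_F ⊗ ℂ` lying in `𝒟ᵐ ⊗ ℂ` is `0`.
[cite: MoonenZarhin1998WeilClasses, §1 Criterion (2) (chunk p0003 L46–L58)] -/
theorem eq_zero_of_mem_weilClassesField_of_mem_divisorClassesSpan_of_not_mem_adjoin (hA : 0 < A.dim)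
    (hQ : IsRationalClass h) (hs : s ≠ 0) (hK : IsKaehlerClass A.dim A.X ((s : ℂ) • h))
    (hPm : P.Monic) (hPe : P.natDegree = e) (hPirr : Irreducible (P.map (Int.castRingHom ℚ)))
    (hφ : Polynomial.eval₂ (Int.castRingHom (CategoryTheory.End A)) (φ : CategoryTheory.End A) P = 0)
    (her : e * (2 * m) = 2 * A.dim) (hm : m ≠ 0)
    (hF : pullbackOne A φ ∉ Algebra.adjoin ℂ (symmetricPullbackSpan A h : Set (Module.End ℂ (complexBetti A.X 1))))
    {c : complexBetti A.X (2 * m)} (hcW : c ∈ weilClassesField A φ P (2 * m))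
    (hcD : c ∈ divisorClassesSpan A.X A.dim m) : c = 0 := by
  have h0 : c ∈ weilClassesField A φ P (2 * m) ⊓ divisorClassesSpan A.X A.dim m := ⟨hcW, hcD⟩
  rwa [weilClassesField_inf_divisorClassesSpan_eq_bot_of_not_mem_adjoin hA hQ hs hK hPm hPe hPirr hφ her hm hF,
    Submodule.mem_bot] at h0

/-! ### §2 Criterion (2) on the carrier: decomposable ⟺ `F ⊆ B` and `G_div(X) ⊆ Sl_F(V_X)` -/

/-- **CRITERION (2) ON THE CARRIER, Lemma (3) built in**: `W_F ⊗ ℂ ≤ 𝒟ᵐ ⊗ ℂ` ⟺ `φ^* ∈ B ⊗ ℂ` AND every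
`u ∈ G_div(X)(ℂ)` has `det(u | V_ρ) = 1` at every complex root `ρ` of `P` («`G_div(X)` acts as the identity on `W_F` if
and only if `F ⊆ B`» ∧ «`G_div(X) ⊆ Sl_F(V_X)`»; `0 < dim A`, `h` rational with a Kähler multiple, `P` monic irreducible
of degree `e`, `P(φ) = 0`, `e · 2m = 2 dim A`). [cite: MoonenZarhin1998WeilClasses, §1 Criterion (2) and its proof (chunk p0003 L46–L70), Lemma (3) (chunk p0003 L5)]
[cite: Milne1999LefschetzClasses, Thm. 3.2, Cor. 4.5] -/
theorem weilClassesField_le_divisorClassesSpan_iff_mem_adjoin_and_forall_detOnEigenspace_eq_one (hA : 0 < A.dim)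
    (hQ : IsRationalClass h) (hs : s ≠ 0) (hK : IsKaehlerClass A.dim A.X ((s : ℂ) • h))
    (hPm : P.Monic) (hPe : P.natDegree = e) (hPirr : Irreducible (P.map (Int.castRingHom ℚ)))
    (hφ : Polynomial.eval₂ (Int.castRingHom (CategoryTheory.End A)) (φ : CategoryTheory.End A) P = 0)
    (her : e * (2 * m) = 2 * A.dim) :
    weilClassesField A φ P (2 * m) ≤ divisorClassesSpan A.X A.dim m ↔
      ∃ hF : pullbackOne A φ ∈ Algebra.adjoin ℂ (symmetricPullbackSpan A h : Set (Module.End ℂ (complexBetti A.X 1))),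
        ∀ u (hu : u ∈ divisorLefschetzGroup A h) (ρ : ℂ), Polynomial.eval₂ (Int.castRingHom ℂ) ρ P = 0 →
          detOnEigenspace u (pullbackOne A φ)
            (comm_pullbackOne_of_mem_divisorLefschetzGroup_of_pullbackOne_mem_adjoin hF hu) ρ = 1 := by
  have hh : h ∈ hodgeClassSpan A.dim A.X 1 := mem_hodgeClassSpan_one_of_isKaehlerClass_smul hQ hs hK
  have hnd : ∀ x : complexBetti A.X 1, (∀ y, polarizationPairingOne A.X h (A.dim - 1) x y = 0) → x = 0 :=
    fun x hx ↦ eq_zero_of_forall_polarizationPairingOne_eq_zero_of_isKaehlerClass_smul' hs hK x hx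
  refine ⟨fun hW ↦ ?_, fun ⟨hF, hdet⟩ ↦ ?_⟩
  · have hF := pullbackOne_mem_adjoin_of_weilClassesField_le_divisorClassesSpan hA hQ hs hK hPm hPe hPirr hφ her hW
    exact ⟨hF, (weilClassesField_le_divisorClassesSpan_iff_forall_detOnEigenspace_eq_one_of_mem_adjoin hPm hPe hPirr hφ
      her hh hnd hF).1 hW⟩
  · exact (weilClassesField_le_divisorClassesSpan_iff_forall_detOnEigenspace_eq_one_of_mem_adjoin hPm hPe hPirr hφ her
      hh hnd hF).2 hdet

/-- **The exceptional alternative, Lemma (3) built in** (`m ≠ 0`): `W_F ⊗ ℂ ⊓ 𝒟ᵐ ⊗ ℂ = ⊥` ⟺ `φ^* ∉ B ⊗ ℂ` OR some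
`u ∈ G_div(X)(ℂ)` commuting with `φ^*` has `det(u | V_ρ) ≠ 1` at some complex root `ρ` of `P` (all-or-nothing, the
tree's `weilClassesField_inf_divisorClassesSpan_eq_bot_or_le`; `W_F ⊗ ℂ ≠ 0`).
[cite: MoonenZarhin1998WeilClasses, §1 Criterion (2) («or all non-zero classes in W_F are exceptional») and its proof (chunk p0003 L46–L90)] -/
theorem weilClassesField_inf_divisorClassesSpan_eq_bot_iff_not_mem_adjoin_or (hA : 0 < A.dim)
    (hQ : IsRationalClass h) (hs : s ≠ 0) (hK : IsKaehlerClass A.dim A.X ((s : ℂ) • h))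
    (hPm : P.Monic) (hPe : P.natDegree = e) (hPirr : Irreducible (P.map (Int.castRingHom ℚ)))
    (hφ : Polynomial.eval₂ (Int.castRingHom (CategoryTheory.End A)) (φ : CategoryTheory.End A) P = 0)
    (her : e * (2 * m) = 2 * A.dim) (hm : m ≠ 0) :
    weilClassesField A φ P (2 * m) ⊓ divisorClassesSpan A.X A.dim m = ⊥ ↔
      pullbackOne A φ ∉ Algebra.adjoin ℂ (symmetricPullbackSpan A h : Set (Module.End ℂ (complexBetti A.X 1))) ∨
        ∃ (u : complexBetti A.X 1 ≃ₗ[ℂ] complexBetti A.X 1) (_ : u ∈ divisorLefschetzGroup A h)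
          (hc : ∀ x, u (pullbackOne A φ x) = pullbackOne A φ (u x)) (ρ : ℂ),
          Polynomial.eval₂ (Int.castRingHom ℂ) ρ P = 0 ∧ detOnEigenspace u (pullbackOne A φ) hc ρ ≠ 1 := by
  have hh : h ∈ hodgeClassSpan A.dim A.X 1 := mem_hodgeClassSpan_one_of_isKaehlerClass_smul hQ hs hK
  have hnd : ∀ x : complexBetti A.X 1, (∀ y, polarizationPairingOne A.X h (A.dim - 1) x y = 0) → x = 0 :=
    fun x hx ↦ eq_zero_of_forall_polarizationPairingOne_eq_zero_of_isKaehlerClass_smul' hs hK x hx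
  constructor
  · intro hbot
    by_contra hno
    push Not at hno
    obtain ⟨hF, hdet⟩ := hno
    have hle : weilClassesField A φ P (2 * m) ≤ divisorClassesSpan A.X A.dim m :=
      (weilClassesField_le_divisorClassesSpan_iff_mem_adjoin_and_forall_detOnEigenspace_eq_one hA hQ hs hK hPm hPe
        hPirr hφ her).2 ⟨hF, fun u hu ρ hρ ↦ hdet u hu _ ρ hρ⟩
    obtain ⟨γ, hγW, -, hγ0⟩ := exists_isRationalClass_ne_zero_mem_weilClassesField hPm hPe hPirr hφ her
    have h0 : γ ∈ weilClassesField A φ P (2 * m) ⊓ divisorClassesSpan A.X A.dim m := ⟨hγW, hle hγW⟩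
    rw [hbot, Submodule.mem_bot] at h0
    exact hγ0 h0
  · rintro (hF | ⟨u, hu, hc, ρ, hρ, hdet⟩)
    · exact weilClassesField_inf_divisorClassesSpan_eq_bot_of_not_mem_adjoin hA hQ hs hK hPm hPe hPirr hφ her hm hF
    · exact weilClassesField_inf_divisorClassesSpan_eq_bot_of_mem_divisorLefschetzGroup_detOnEigenspace_ne_one hPm hPe
        hPirr hφ her hm hh hnd hu hc hρ hdet

end HodgeTheory

end Literature.AlgebraicGeometry.HodgeTheory

end
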